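import Summits.BirchSwinnertonDyer.BirchSwinnertonDyer.Theorems.KolyvaginRankRigidityAtTwoChebotarevOneClassAtTwoAlgebra
import HarnessLib

/-!
# Crux V2♭θ `KolyvaginCorankLowerBoundAtTwoTheta` (stmt-BirchSwinnertonDyer-27220), line
# `kolyvagin_depth_split`, inside of S1: BRICK B AT `2` FROM ZHANG'S NUMERICS ONLY — the
# `±`-eigen-subgroups on `E[2^M](ℚ̄)` of ANY `g ∈ Γ_ℚ` that inverts `μ_{2^{M+1}}` and squares to `1` on
# `E[2^{M+1}]` have `≤ 2^{M+1}` elements and contain a point of order `2^M`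
# (helper, PROVED; width seat `bsd-line-krr2-p2` g7; answers the lead's design question of 11:17Z)

Seat g6's brick B at `2` (`Theorems/KolyvaginRankRigidityAtTwoSwapFrobeniusEigenLinesAtTwo.lean`) reads
the balanced eigenspaces of the `ℚ`-Frobenius at a Kolyvagin prime off Gross's Frobenius condition
(3.2) `FrobEqFrobInfty W K (2^{M'}) ℓ` (the Frobenius is conjugate to complex conjugation).  At the prime
being SWAPPED OUT in Kolyvagin's prime swap (a seed prime of the crux statement's `KolSupp`) only Zhang's
numerical condition `2^{M+1} ∣ ℓ + 1, a_ℓ` (index `≥ M + 1`) is available.  This file shows that the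
numerics suffice, at the cost of ONE extra level: the two uses of `IsComplexConjugation c₀` in g6's
proofs are (i) `c₀ ζ = ζ⁻¹` on `2`-power roots of unity and (ii) `c₀² = 1`; (i) holds for a Frobenius
at `ℓ` with `2^m ∣ ℓ + 1` (`Frob ζ = ζ^ℓ`), and (ii) is needed only ON `E[2^{M+1}]`, where it is the
Kolyvagin condition of index `≥ M + 1` (`Γ_{K_λ}` fixes `E[2^{M+1}]`, Jetchev §3.2).

* `exists_pow_smul_add_sign_ne_zero_of_smul_eq_inv` — `(1 + ε g) E[2^m] ⊄ E[2^m][2^{m-2}]` for `g`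
  inverting `μ_{2^m}` (g6's Weil-pairing proof verbatim);
* `natCard_ker_sub_smul_le_of_smul_eq_inv` — `#ker(g − s | E[2^M]) ≤ 2^{M+1}` (no involution needed);
* `exists_eigen_pow_smul_ne_zero_of_smul_eq_inv_of_sq` — an `s`-eigenvector of ORDER `2^M` in `E[2^M]`
  when moreover `g² = 1` on `E[2^{M+1}]` (symmetrise at level `M + 1`; g6 symmetrised a genuine
  involution at level `2M`).  The extra level is sharp: `F = [[3,2],[2,1]] (mod 4)` has `F² = 1`,
  `det F = −1` and both eigenspaces `= E[2]` on `E[4]`, yet `±`-eigenvectors of order `2` in `E[2] = 2·E[4]`.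

The Frobenius supply (an arithmetic Frobenius at a Zhang–Kolyvagin prime `ℓ` with `k + 1 ≤ M(ℓ)`
satisfies both hypotheses at level `2^{k+1}`) and the transport to the local Kummer group are separate
files.  HONEST FRAMING: helper lemmas (`--supports` 27220); S1 / V2♭θ are NOT proved; BSD is not proved.

References: [GrossLMS1991] §3 (3.2)–(3.4); [Jetchev2008] §3.2 (2); [SilvermanAEC2009] Prop. III.8.1;
[McCallumLMS1991] §3–§4; [WZhang2014] Notations (xii) (Kolyvagin index).
-/

set_option autoImplicit false
-- the Theorems namespace of this sub repeats the summit name by design (D-0017 nested layout)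
set_option linter.dupNamespace false

noncomputable section

open scoped Classical

namespace Summit.BirchSwinnertonDyer.BirchSwinnertonDyer.Theorems.KolyvaginLowerBoundAtTwo

open WeierstrassCurve Field
open Literature.NumberTheory.GaloisRepresentations Literature.NumberTheory.EllipticCurves

/-! ### One bit from the Weil pairing -/

/-- **An element of `Γ_ℚ` inverting `μ_{2^m}` is never `∓1` modulo `4` on `E[2^m]`** (`m ≥ 2`): for
`ε = ±1` some `x ∈ E(ℚ̄)[2^m]` has `2^{m-2} (x + ε c₀ x) ≠ 0`, i.e. `(1 + ε c₀) E[2^m] ⊄ E[2^m][2^{m-2}]`.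
Seat g6's `exists_pow_smul_add_sign_conj_ne_zero` VERBATIM with the single use of
`IsComplexConjugation` (`c₀ ζ = ζ⁻¹` on `μ_{2^m}`, `RatClosure.smul_eq_inv_of_pow_eq_one`) turned into the
hypothesis `hc₀` — so it applies to an arithmetic Frobenius at a prime `ℓ` with `2^m ∣ ℓ + 1`
(`Frob ζ = ζ^ℓ = ζ⁻¹`), i.e. to Kolyvagin primes in Zhang's NUMERICAL sense, without Gross's (3.2).
Proof by the Weil pairing (`det c₀ = −1`): `c₀ ≡ -ε (mod E[2^{m-2}]·)` would give `c₀ ζ ≡ ζ` modulo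
`μ_{2^{m-2}}` for a pairing value `ζ` of order `≥ 2^{m-1}`.
[cite: SilvermanAEC2009, Prop. III.8.1] [cite: McCallumLMS1991, §3 (before Prop. 3.1)]
[cite: GrossLMS1991, §3 (3.3)–(3.4)] -/
theorem exists_pow_smul_add_sign_ne_zero_of_smul_eq_inv (W : WeierstrassCurve ℚ) [W.IsElliptic]
    {c₀ : absoluteGaloisGroup ℚ} {m : ℕ} (hm : 2 ≤ m)
    (hc₀ : ∀ ζ : AlgebraicClosure ℚ, ζ ^ (2 ^ m) = 1 → c₀ • ζ = ζ⁻¹)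
    {ε : ℤ} (hε : ε = 1 ∨ ε = -1) :
    ∃ x : geomTorsion W ((2 ^ m : ℕ) : ℤ), (2 ^ (m - 2)) • (x + ε • c₀ • x) ≠ 0 := by
  by_contra! hall
  -- the Weil pairing on `E[2^m]`
  have h2m : 2 ≤ 2 ^ m := by
    calc 2 = 2 ^ 1 := by norm_num
      _ ≤ 2 ^ m := Nat.pow_le_pow_right (by norm_num) (by omega)
  have hq0 : ((2 ^ m : ℕ) : ℚ) ≠ 0 := by positivity
  obtain ⟨w, hpow, haddl, haddr, halt, hnd, hgal⟩ := W.exists_weilPairing_holds (2 ^ m) h2m hq0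
  have hne : ∀ S T, w S T ≠ 0 := fun S T h0 ↦ by
    have := hpow S T
    rw [h0, zero_pow (by positivity)] at this
    exact zero_ne_one this
  have hzero_left : ∀ T, w 0 T = 1 := fun T ↦ by
    have h := haddl 0 0 T
    rw [add_zero] at h
    exact (mul_eq_left₀ (hne 0 T)).mp h.symm
  have hzero_right : ∀ S, w S 0 = 1 := fun S ↦ by
    have h := haddr S 0 0
    rw [add_zero] at h
    exact (mul_eq_left₀ (hne S 0)).mp h.symm
  have hnsmul_left : ∀ (a : ℕ) S T, w (a • S) T = w S T ^ a := fun a S T ↦ by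
    induction a with
    | zero => rw [zero_nsmul, pow_zero, hzero_left]
    | succ a ih => rw [succ_nsmul, haddl, ih, pow_succ]
  have hnsmul_right : ∀ (a : ℕ) S T, w S (a • T) = w S T ^ a := fun a S T ↦ by
    induction a with
    | zero => rw [zero_nsmul, pow_zero, hzero_right]
    | succ a ih => rw [succ_nsmul, haddr, ih, pow_succ]
  have hneg_left : ∀ S T, w (-S) T = (w S T)⁻¹ := fun S T ↦ by
    have h := haddl (-S) S T
    rw [neg_add_cancel, hzero_left] at h
    exact (eq_inv_of_mul_eq_one_left h.symm)
  have hneg_right : ∀ S T, w S (-T) = (w S T)⁻¹ := fun S T ↦ by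
    have h := haddr S (-T) T
    rw [neg_add_cancel, hzero_right] at h
    exact (eq_inv_of_mul_eq_one_left h.symm)
  have hsub_left : ∀ S S' T, w (S - S') T = w S T * (w S' T)⁻¹ := fun S S' T ↦ by
    rw [sub_eq_add_neg, haddl, hneg_left]
  have hsub_right : ∀ S T T', w S (T - T') = w S T * (w S T')⁻¹ := fun S T T' ↦ by
    rw [sub_eq_add_neg, haddr, hneg_right]
  -- the sign does not change the pairing of two conjugated points
  have hsign : ∀ S T, w (ε • c₀ • S) (ε • c₀ • T) = w (c₀ • S) (c₀ • T) := fun S T ↦ by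
    rcases hε with rfl | rfl
    · rw [one_zsmul, one_zsmul]
    · rw [neg_one_zsmul, neg_one_zsmul, hneg_left, hneg_right, inv_inv]
  -- a point `S₀` of exact order `2^m` (frame `E[2^m] ≃ (ℤ/2^m)²`)
  obtain ⟨e⟩ := nonempty_addEquiv_geomTorsion W 2 m (by omega) (by norm_num)
  set S₀ : geomTorsion W ((2 ^ m : ℕ) : ℤ) := e.symm (Pi.single 0 1) with hS₀
  have hS₀ne : (2 ^ (m - 1)) • S₀ ≠ 0 := by
    intro h0
    have h1 : e ((2 ^ (m - 1)) • S₀) 0 = 0 := by rw [h0, map_zero, Pi.zero_apply]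
    rw [map_nsmul, hS₀, e.apply_symm_apply, Pi.smul_apply, Pi.single_eq_same, nsmul_eq_mul,
      mul_one] at h1
    have h2 : ((2 ^ (m - 1) : ℕ) : ZMod (2 ^ m)) = 0 := by exact_mod_cast h1
    rw [ZMod.natCast_eq_zero_iff] at h2
    have h3 : 2 ^ m ≤ 2 ^ (m - 1) := Nat.le_of_dvd (by positivity) h2
    have h4 : 2 ^ (m - 1) < 2 ^ m := Nat.pow_lt_pow_right (by norm_num) (by omega)
    omega
  -- a partner `S'` with `ζ = e(S', S₀)` of order `≥ 2^{m-1}`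
  obtain ⟨S', hS'⟩ : ∃ S', w S' ((2 ^ (m - 1)) • S₀) ≠ 1 := by
    by_contra! h
    exact hS₀ne (hnd _ h)
  have hζ : w S' S₀ ^ (2 ^ (m - 1)) ≠ 1 := by rwa [← hnsmul_right]
  -- `c₀` inverts `ζ`
  have hinv : c₀ • w S' S₀ = (w S' S₀)⁻¹ :=
    hc₀ _ (hpow S' S₀)
  -- and, under `hall`, multiplies it by a `2^{m-2}`-th root of unity
  set u := S' + ε • c₀ • S' with hu
  set v := S₀ + ε • c₀ • S₀ with hv
  have hu0 : (2 ^ (m - 2)) • u = 0 := hall S'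
  have hv0 : (2 ^ (m - 2)) • v = 0 := hall S₀
  have hcS' : ε • c₀ • S' = u - S' := by rw [hu, add_sub_cancel_left]
  have hcS₀ : ε • c₀ • S₀ = v - S₀ := by rw [hv, add_sub_cancel_left]
  set η := w u v * (w u S₀)⁻¹ * (w S' v)⁻¹ with hη
  have hconj : c₀ • w S' S₀ = w S' S₀ * η := by
    rw [hη, hgal, ← hsign, hcS', hcS₀, hsub_left, hsub_right, hsub_right, mul_inv, inv_inv]
    ring
  have hroot : η ^ (2 ^ (m - 2)) = 1 := by
    rw [hη, mul_pow, mul_pow, inv_pow, inv_pow, ← hnsmul_left, ← hnsmul_left, ← hnsmul_right, hu0,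
      hv0, hzero_left, hzero_left, hzero_right, inv_one, mul_one, mul_one]
  have hη0 : η ≠ 0 := by
    rw [hη]
    exact mul_ne_zero (mul_ne_zero (hne _ _) (inv_ne_zero (hne _ _))) (inv_ne_zero (hne _ _))
  -- so `ζ² = η⁻¹ ∈ μ_{2^{m-2}}`, i.e. `ζ^{2^{m-1}} = 1`: contradiction
  apply hζ
  have hsq : w S' S₀ ^ 2 = η⁻¹ := by
    have h : (w S' S₀)⁻¹ = w S' S₀ * η := hinv.symm.trans hconj
    have h1 : w S' S₀ ^ 2 * η = 1 := by
      rw [pow_two, mul_assoc, ← h, mul_inv_cancel₀ (hne S' S₀)]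
    exact eq_inv_of_mul_eq_one_left h1
  have hm2 : 2 ^ (m - 1) = 2 * 2 ^ (m - 2) := by
    rw [← pow_succ']
    congr 1
    omega
  rw [hm2, pow_mul, hsq, inv_pow, hroot, inv_one]



/-! ### Eigen-subgroups: size `≤ 2^{M+1}`, an eigenvector of order `2^M` -/

variable (W : WeierstrassCurve ℚ) [W.IsElliptic]

/-- **`#ker(c₀ − s | E[2^M](ℚ̄)) ≤ 2^{M+1}`** for ANY `c₀ ∈ Γ_ℚ` inverting the `2^M`-th roots of unity
(`s = ±1`, `M ≥ 1`; no involution hypothesis): `(c₀ − s) E[2^M]` contains an element of order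
`≥ 2^{M-1}` (`exists_pow_smul_add_sign_ne_zero_of_smul_eq_inv` with `ε = -s`) and `#E[2^M] = 2^{2M}`.
Seat g6's `natCard_ker_conj_sub_smul_le` is the case of a complex conjugation.
[cite: GrossLMS1991, §3 (3.4)] [cite: SilvermanAEC2009, Prop. III.8.1] -/
theorem natCard_ker_sub_smul_le_of_smul_eq_inv {c₀ : absoluteGaloisGroup ℚ} {M : ℕ} (hM : 1 ≤ M)
    (hc₀ : ∀ ζ : AlgebraicClosure ℚ, ζ ^ (2 ^ M) = 1 → c₀ • ζ = ζ⁻¹) {s : ℤ}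
    (hs : s = 1 ∨ s = -1) :
    Nat.card (DistribSMul.toAddMonoidHom (geomTorsion W ((2 ^ M : ℕ) : ℤ)) c₀ -
        s • AddMonoidHom.id _).ker ≤ 2 ^ (M + 1) := by
  set T := geomTorsion W ((2 ^ M : ℕ) : ℤ) with hT
  set f : T →+ T := DistribSMul.toAddMonoidHom T c₀ - s • AddMonoidHom.id _ with hf
  have hfapply : ∀ x : T, f x = c₀ • x - s • x := fun _ => rfl
  have hn0 : ((2 ^ M : ℕ) : ℤ) ≠ 0 := by positivity
  haveI : Finite T := finite_torsionPoints_holds W (AlgebraicClosure ℚ) hn0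
  have hcard : Nat.card T = 2 ^ (2 * M) := by
    rw [hT, mul_comm, pow_mul]
    exact card_torsionPoints_eq_sq_holds W (AlgebraicClosure ℚ) (n := 2 ^ M)
      (by exact_mod_cast pow_ne_zero M two_ne_zero)
  have hsplit : Nat.card T = Nat.card f.ker * Nat.card f.range := by
    rw [← Nat.card_congr (QuotientAddGroup.quotientKerEquivRange f).toEquiv, mul_comm]
    exact f.ker.card_eq_card_quotient_mul_card_addSubgroup
  rcases Nat.lt_or_ge M 2 with hM1 | hM2
  · have hM1' : M = 1 := by omega
    subst hM1'
    calc Nat.card f.ker ≤ Nat.card T := Nat.card_le_card_of_injective _ Subtype.val_injective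
      _ = 2 ^ (1 + 1) := by rw [hcard]
  · have hε : (-s) = 1 ∨ (-s) = -1 := by rcases hs with rfl | rfl <;> simp
    obtain ⟨x, hx⟩ := exists_pow_smul_add_sign_ne_zero_of_smul_eq_inv W hM2 hc₀ hε
    have hfx : x + (-s) • c₀ • x = (-s) • f x := by
      rw [hfapply, smul_sub, smul_smul, show -s * s = -1 by rcases hs with rfl | rfl <;> norm_num,
        neg_one_zsmul, sub_neg_eq_add, add_comm]
    have hne : (2 ^ (M - 2)) • f x ≠ 0 := by
      intro h0
      apply hx
      rw [hfx, smul_comm, h0, smul_zero]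
    have hexp : (2 ^ M) • f x = 0 := Subtype.ext (by
      rw [AddSubgroup.coe_nsmul, AddSubgroup.coe_zero, ← natCast_zsmul, Nat.cast_pow, Nat.cast_ofNat]
      have := (mem_geomTorsion_iff W _ _).mp (f x).2
      exact_mod_cast this)
    -- the order of `f x` is `2^r` with `r ≥ M - 1`
    have hdvd : 2 ^ (M - 2 + 1) ∣ addOrderOf (f x) := by
      have h1 : addOrderOf (f x) ∣ 2 ^ M := addOrderOf_dvd_of_nsmul_eq_zero hexp
      obtain ⟨r, -, hre⟩ := (Nat.dvd_prime_pow Nat.prime_two).mp h1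
      rw [hre]
      apply Nat.pow_dvd_pow
      by_contra hlt
      push Not at hlt
      apply hne
      have : addOrderOf (f x) ∣ 2 ^ (M - 2) := by rw [hre]; exact Nat.pow_dvd_pow 2 (by omega)
      exact addOrderOf_dvd_iff_nsmul_eq_zero.mp this
    have hrange : 2 ^ (M - 1) ∣ Nat.card f.range := by
      rw [show M - 1 = M - 2 + 1 by omega]
      refine hdvd.trans ?_
      have hmem : f x ∈ f.range := ⟨x, rfl⟩
      have := addOrderOf_dvd_natCard (⟨f x, hmem⟩ : f.range)
      rwa [← AddSubgroup.addOrderOf_coe] at this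
    obtain ⟨q, hq⟩ := hrange
    have hqpos : 0 < q := by
      rcases Nat.eq_zero_or_pos q with rfl | h
      · exfalso
        rw [mul_zero] at hq
        exact (Nat.card_pos (α := f.range)).ne' hq
      · exact h
    have e : Nat.card f.ker * q * 2 ^ (M - 1) = 2 ^ (M + 1) * 2 ^ (M - 1) := by
      rw [← pow_add, show M + 1 + (M - 1) = 2 * M by omega, ← hcard, hsplit, hq]; ring
    have e' : Nat.card f.ker * q = 2 ^ (M + 1) := Nat.eq_of_mul_eq_mul_right (by positivity) e
    calc Nat.card f.ker = Nat.card f.ker * 1 := (mul_one _).symm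
      _ ≤ Nat.card f.ker * q := Nat.mul_le_mul_left _ hqpos
      _ = 2 ^ (M + 1) := e'

/-- **An `s`-eigenvector of order `2^M` in `E[2^M](ℚ̄)`** for any `c₀ ∈ Γ_ℚ` that inverts the
`2^{M+1}`-th roots of unity and squares to the identity ON `E[2^{M+1}]` (`s = ±1`, `M ≥ 1`): symmetrise a
point of `E[2^{M+1}]` (`y = x + s c₀ x` has order `≥ 2^M` by `exists_pow_smul_add_sign_ne_zero_of_smul_eq_inv`
at level `M + 1`) and take `y` or `2y`.  The extra level is essential: on `E[2^{M+1}]` itself the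
eigenspaces can be `E[2]` (`F = [[3,2],[2,1]] mod 4`).  Seat g6's `exists_conj_eigen_pow_smul_ne_zero` is
the case of a complex conjugation (which symmetrised at level `2M`).
[cite: GrossLMS1991, §3 (3.4)] [cite: SilvermanAEC2009, Prop. III.8.1] -/
theorem exists_eigen_pow_smul_ne_zero_of_smul_eq_inv_of_sq {c₀ : absoluteGaloisGroup ℚ} {M : ℕ}
    (hM : 1 ≤ M) (hc₀ : ∀ ζ : AlgebraicClosure ℚ, ζ ^ (2 ^ (M + 1)) = 1 → c₀ • ζ = ζ⁻¹)
    (hsq : ∀ P : geomTorsion W ((2 ^ (M + 1) : ℕ) : ℤ), c₀ • c₀ • P = P) {s : ℤ}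
    (hs : s = 1 ∨ s = -1) :
    ∃ P : geomTorsion W ((2 ^ M : ℕ) : ℤ), c₀ • P = s • P ∧ (2 ^ (M - 1)) • P ≠ 0 := by
  have h2M : 2 ≤ M + 1 := by omega
  obtain ⟨x, hx⟩ := exists_pow_smul_add_sign_ne_zero_of_smul_eq_inv W h2M hc₀ hs
  have hs2 : s * s = 1 := by rcases hs with rfl | rfl <;> norm_num
  set y := x + s • c₀ • x with hy
  -- `y` is an `s`-eigenvector (`c₀² = 1` on `E[2^{M+1}]`)
  have hy_eig : c₀ • y = s • y := by
    rw [hy, smul_add, smul_comm c₀ s, hsq, smul_add, smul_smul, hs2, one_smul]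
    exact add_comm _ _
  have hyP : c₀ • (y : W.geomPoints) = s • (y : W.geomPoints) := by
    have := congrArg Subtype.val hy_eig
    rwa [AddSubgroup.torsionBy.coe_smul, AddSubgroup.coe_zsmul] at this
  have hy0 : ((2 ^ (M + 1) : ℕ) : ℤ) • (y : W.geomPoints) = 0 := (mem_geomTorsion_iff W _ _).mp y.2
  have hx' : (2 ^ (M + 1 - 2)) • (y : W.geomPoints) ≠ 0 := by
    intro h0
    apply hx
    exact Subtype.ext (by rw [AddSubgroup.coe_nsmul, h0, AddSubgroup.coe_zero])
  -- the Galois action commutes with multiples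
  have hsmul_nsmul : ∀ (g : absoluteGaloisGroup ℚ) (n : ℕ) (Q : W.geomPoints),
      g • (n • Q) = n • (g • Q) := fun g n Q => smul_comm g n Q
  by_cases hcase : (2 ^ M) • (y : W.geomPoints) = 0
  · -- `P = y`
    have hmem : (2 ^ 0) • (y : W.geomPoints) ∈ geomTorsion W ((2 ^ M : ℕ) : ℤ) := by
      rw [mem_geomTorsion_iff, natCast_zsmul, ← mul_nsmul', ← pow_add, add_zero, hcase]
    refine ⟨⟨_, hmem⟩, Subtype.ext ?_, fun h0 => hx' ?_⟩
    · rw [AddSubgroup.torsionBy.coe_smul, AddSubgroup.coe_zsmul]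
      change c₀ • ((2 ^ 0) • (y : W.geomPoints)) = s • ((2 ^ 0) • (y : W.geomPoints))
      rw [hsmul_nsmul, hyP, smul_comm]
    · have h1 := congrArg Subtype.val h0
      rw [AddSubgroup.coe_nsmul, AddSubgroup.coe_zero] at h1
      change (2 ^ (M - 1)) • ((2 ^ 0) • (y : W.geomPoints)) = 0 at h1
      rwa [← mul_nsmul', ← pow_add, show M - 1 + 0 = M + 1 - 2 by omega] at h1
  · -- `P = 2 y`
    have hmem : (2 ^ 1) • (y : W.geomPoints) ∈ geomTorsion W ((2 ^ M : ℕ) : ℤ) := by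
      rw [mem_geomTorsion_iff, natCast_zsmul, ← mul_nsmul', ← pow_add]
      exact_mod_cast hy0
    refine ⟨⟨_, hmem⟩, Subtype.ext ?_, fun h0 => hcase ?_⟩
    · rw [AddSubgroup.torsionBy.coe_smul, AddSubgroup.coe_zsmul]
      change c₀ • ((2 ^ 1) • (y : W.geomPoints)) = s • ((2 ^ 1) • (y : W.geomPoints))
      rw [hsmul_nsmul, hyP, smul_comm]
    · have h1 := congrArg Subtype.val h0
      rw [AddSubgroup.coe_nsmul, AddSubgroup.coe_zero] at h1
      change (2 ^ (M - 1)) • ((2 ^ 1) • (y : W.geomPoints)) = 0 at h1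
      rwa [← mul_nsmul', ← pow_add, show M - 1 + 1 = M by omega] at h1


end Summit.BirchSwinnertonDyer.BirchSwinnertonDyer.Theorems.KolyvaginLowerBoundAtTwo

end
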